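import Summits.CriticalPhenomena.PercolationContinuityZ3.Theorems.PercNearOneGluingNoHeavyLowerTailNineTypeAssembly

/-!
# Nine-type programme for `Q44b`: the RADICAL (half-circuit) certificate

Support file for crux `stmt-CriticalPhenomena-4575` (master-family programme, quadratic four-point row `Q44b`,
GF(2)-rank line of `prim-bnk-1` gen 16–19), seat `prim-bnk-1` gen 19; memo
`run/shared/lean/prim/prim-l12/FROM-prim-bnk-1-gen19-HALL-GRAM-ASSEMBLY.md` §7.

All five circuit lemmas of gen 18 (twins, rectangles, forks, dual forks, joins) exhibit, for the top `t` of an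
H-circuit `C`, a detector `d` with `⟨d, v_s⟩ = 0` for every H-row and `⟨d, w_t⟩ = 1`.  The memo's new observation
(0 exceptions: INT `m ≤ 5` exhaustive, `m = 6, 7` samples, GEN `m = 5, 6`, forced and `π_min` goods) is that for every
PURE dependency `E` (members of types `5,7,8,9` only) one single detector works: the HALF-SUM
`σ_E = Σ_{y ∈ E free} v_y`, i.e. the function `u ↦ #{y ∈ Y : y ⊆ u} mod 2` on the goods, `Y` = free members of `E`.
Conjecture PHO (memo §7): `σ_E` is orthogonal to every H-row.  This file proves the deterministic half:

* `NineType.radical_certificate` — if `t ∈ Y`, every `y ∪ tᶜ` (`y ∈ Y`) is good, no member of `Y` strictly contains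
  `t`, and the half-sum detector of `Y` is orthogonal to the H-rows of all `s ∈ S`
  (`Σ_{u ∈ 𝔊, s ⊆ u} #{y ∈ Y : y ⊆ u} ≡ 0`), then `S` does not represent the L-row of `t`
  (`#{s ∈ S : s ⊆ g} ≡ [tᶜ ⊆ g]` for all goods `g` is impossible).  No types, no circuit hypothesis: a statement about
  two set families and an up-set.
* `NineType.pure_top_L_row_not_H_combination` — the typed instance: `Y ⊆ 𝒯` consists of free points (types 5/7),
  `t ∈ Y` has maximal cardinality in `Y`, HL-forced goods are in `𝔊`; then orthogonality of the half-sum of `Y` to all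
  H-rows of `𝒯` (hypothesis `hrad`, = PHO for `Y = E ∩ F`) forbids any H-representation of the L-row of `t`.
* `NineType.pure_corank_one_card_le` — with `card_le_card_of_pivot`: if in addition every H-dependency passes through
  `t` and COV holds, then `#𝒯 ≤ #𝔊`.

Pure finite combinatorics; no named facts, no sorries, standard axioms.
-/

namespace Summit.CriticalPhenomena.PercolationContinuityZ3.Theorems

namespace NineType

open Finset

variable {α : Type*} [DecidableEq α] [Fintype α]

/-- **Radical (half-sum) certificate.**  Let `𝔊` be an up-set, `Y` a family, `t ∈ Y` with `y ∪ tᶜ ∈ 𝔊` for all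
`y ∈ Y` and no `y ∈ Y` strictly above `t`.  If the detector `u ↦ #{y ∈ Y : y ⊆ u} (mod 2)` is orthogonal to the
H-row of every `s ∈ S`, then `S` does not represent the L-row of `t` over `𝔊`. [this work] -/
theorem radical_certificate (𝔊 : Finset (Finset α))
    (hG : ∀ g ∈ 𝔊, ∀ g' : Finset α, g ⊆ g' → g' ∈ 𝔊)
    (Y : Finset (Finset α)) (t : Finset α) (ht : t ∈ Y)
    (hHL : ∀ y ∈ Y, y ∪ tᶜ ∈ 𝔊) (hmax : ∀ y ∈ Y, t ⊆ y → y = t)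
    (S : Finset (Finset α))
    (hrad : ∀ s ∈ S, (∑ u ∈ 𝔊.filter (fun u => s ⊆ u),
      ((#(Y.filter (fun y => y ⊆ u)) : ℕ) : ZMod 2)) = 0) :
    ¬ (∀ g ∈ 𝔊, ((#(S.filter (fun s => s ⊆ g)) : ℕ) : ZMod 2) = if tᶜ ⊆ g then 1 else 0) := by
  intro hrel
  -- D := Σ_{u ∈ 𝔊} σ(u) · #{s ∈ S : s ⊆ u}, σ(u) = #{y ∈ Y : y ⊆ u}  (all mod 2)
  set σ : Finset α → ZMod 2 := fun u => ((#(Y.filter (fun y => y ⊆ u)) : ℕ) : ZMod 2) with hσ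
  -- first evaluation: via the relation, D = Σ_{y ∈ Y} [y ∪ tᶜ = univ] = 1
  have h1 : ∑ u ∈ 𝔊, σ u * (((#(S.filter (fun s => s ⊆ u)) : ℕ) : ZMod 2)) = 1 := by
    calc ∑ u ∈ 𝔊, σ u * (((#(S.filter (fun s => s ⊆ u)) : ℕ) : ZMod 2))
        = ∑ u ∈ 𝔊, σ u * (if tᶜ ⊆ u then (1 : ZMod 2) else 0) := by
          refine Finset.sum_congr rfl fun u hu => ?_
          rw [hrel u hu]
      _ = ∑ u ∈ 𝔊, ∑ y ∈ Y, (if y ∪ tᶜ ⊆ u then (1 : ZMod 2) else 0) := by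
          refine Finset.sum_congr rfl fun u _ => ?_
          rw [hσ]
          simp only
          rw [card_filter_cast, Finset.sum_mul]
          refine Finset.sum_congr rfl fun y _ => ?_
          by_cases hyu : y ⊆ u
          · by_cases htu : tᶜ ⊆ u
            · rw [if_pos hyu, if_pos htu, if_pos (Finset.union_subset hyu htu), one_mul]
            · rw [if_pos hyu, if_neg htu, if_neg (fun h => htu (subset_union_right.trans h)), mul_zero]
          · rw [if_neg hyu, if_neg (fun h => hyu (subset_union_left.trans h)), zero_mul]
      _ = ∑ y ∈ Y, ∑ u ∈ 𝔊, (if y ∪ tᶜ ⊆ u then (1 : ZMod 2) else 0) := Finset.sum_comm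
      _ = ∑ y ∈ Y, (if y = t then (1 : ZMod 2) else 0) := by
          refine Finset.sum_congr rfl fun y hy => ?_
          rw [← card_filter_cast, card_supersets_parity 𝔊 hG (y ∪ tᶜ) (hHL y hy)]
          by_cases hyt : y = t
          · rw [if_pos hyt, if_pos]
            rw [hyt]
            exact Finset.union_compl t
          · rw [if_neg hyt, if_neg]
            intro huniv
            apply hyt
            apply hmax y hy
            intro x hx
            have hx' : x ∈ y ∪ tᶜ := by rw [huniv]; exact Finset.mem_univ x
            rcases Finset.mem_union.1 hx' with h | h
            · exact h
            · exact absurd hx (Finset.mem_compl.1 h)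
      _ = 1 := by
          rw [Finset.sum_ite_eq' Y t, if_pos ht]
  -- second evaluation: swap the sums; every `s ∈ S` contributes 0 by orthogonality
  have h2 : ∑ u ∈ 𝔊, σ u * (((#(S.filter (fun s => s ⊆ u)) : ℕ) : ZMod 2)) = 0 := by
    calc ∑ u ∈ 𝔊, σ u * (((#(S.filter (fun s => s ⊆ u)) : ℕ) : ZMod 2))
        = ∑ u ∈ 𝔊, ∑ s ∈ S, (if s ⊆ u then σ u else 0) := by
          refine Finset.sum_congr rfl fun u _ => ?_
          rw [card_filter_cast, Finset.mul_sum]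
          refine Finset.sum_congr rfl fun s _ => ?_
          by_cases hsu : s ⊆ u
          · rw [if_pos hsu, if_pos hsu, mul_one]
          · rw [if_neg hsu, if_neg hsu, mul_zero]
      _ = ∑ s ∈ S, ∑ u ∈ 𝔊, (if s ⊆ u then σ u else 0) := Finset.sum_comm
      _ = ∑ s ∈ S, ∑ u ∈ 𝔊.filter (fun u => s ⊆ u), σ u := by
          refine Finset.sum_congr rfl fun s _ => ?_
          rw [Finset.sum_filter]
      _ = 0 := Finset.sum_eq_zero fun s hs => hrad s hs
  rw [h2] at h1
  exact zero_ne_one h1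

/-- Table fact: free types are pairwise HL-compatible (`hlOK a b` for `a, b ∈ {5,7}`). -/
theorem hlOK_free (a b : ℕ) (ha : a = 5 ∨ a = 7) (hb : b = 5 ∨ b = 7) : hlOK a b = true := by
  rcases ha with rfl | rfl <;> rcases hb with rfl | rfl <;> decide

/-- **Half-sum certificate for a pure circuit top (typed form).**  Let `Y ⊆ 𝒯` consist of free points (types 5/7),
with HL-forced goods in the up-set `𝔊`, and let `t ∈ Y` have maximal cardinality in `Y`.  If the half-sum detector
of `Y` is orthogonal to the H-row of every point of `𝒯` (conjecture PHO of the memo, for `Y` = the free half of a pure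
H-dependency), then no `S ⊆ 𝒯` represents the L-row of `t`. [this work] -/
theorem pure_top_L_row_not_H_combination (𝒯 : Finset (Finset α)) (θ : Finset α → ℕ)
    (𝔊 : Finset (Finset α)) (hG : ∀ g ∈ 𝔊, ∀ g' : Finset α, g ⊆ g' → g' ∈ 𝔊)
    (hHL : ∀ s ∈ 𝒯, ∀ s' ∈ 𝒯, hlOK (θ s) (θ s') = true → s ∪ s'ᶜ ∈ 𝔊)
    (Y : Finset (Finset α)) (hY : Y ⊆ 𝒯) (hYfree : ∀ y ∈ Y, θ y = 5 ∨ θ y = 7)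
    (t : Finset α) (ht : t ∈ Y) (htmax : ∀ y ∈ Y, #y ≤ #t)
    (hrad : ∀ s ∈ 𝒯, (∑ u ∈ 𝔊.filter (fun u => s ⊆ u),
      ((#(Y.filter (fun y => y ⊆ u)) : ℕ) : ZMod 2)) = 0)
    (S : Finset (Finset α)) (hS : S ⊆ 𝒯) :
    ¬ (∀ g ∈ 𝔊, ((#(S.filter (fun s => s ⊆ g)) : ℕ) : ZMod 2) = if tᶜ ⊆ g then 1 else 0) := by
  refine radical_certificate 𝔊 hG Y t ht ?_ ?_ S (fun s hs => hrad s (hS hs))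
  · intro y hy
    exact hHL y (hY hy) t (hY ht) (hlOK_free _ _ (hYfree y hy) (hYfree t ht))
  · intro y hy hty
    exact (Finset.eq_of_subset_of_card_le hty (htmax y hy)).symm

/-- **Corollary (pure circuit through its top, corank one ⟹ count, modulo PHO).**  In a COV configuration with
HL-forced goods in the up-set `𝔊`, let `Y ⊆ 𝒯` be free points whose half-sum detector is orthogonal to all H-rows,
`t ∈ Y` of maximal cardinality, and suppose every H-dependency of `𝒯` passes through `t`.  Then `#𝒯 ≤ #𝔊`.
[this work] -/
theorem pure_corank_one_card_le (𝒯 : Finset (Finset α)) (θ : Finset α → ℕ)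
    (hcov : ∀ s ∈ 𝒯, ∀ s' ∈ 𝒯, s ≠ s' → s ∪ s' ≠ univ)
    (𝔊 : Finset (Finset α)) (hG : ∀ g ∈ 𝔊, ∀ g' : Finset α, g ⊆ g' → g' ∈ 𝔊)
    (hHL : ∀ s ∈ 𝒯, ∀ s' ∈ 𝒯, hlOK (θ s) (θ s') = true → s ∪ s'ᶜ ∈ 𝔊)
    (Y : Finset (Finset α)) (hY : Y ⊆ 𝒯) (hYfree : ∀ y ∈ Y, θ y = 5 ∨ θ y = 7)
    (t : Finset α) (ht : t ∈ Y) (htmax : ∀ y ∈ Y, #y ≤ #t) (htne : tᶜ ≠ t)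
    (hrad : ∀ s ∈ 𝒯, (∑ u ∈ 𝔊.filter (fun u => s ⊆ u),
      ((#(Y.filter (fun y => y ⊆ u)) : ℕ) : ZMod 2)) = 0)
    (hdep : ∀ 𝒮 ⊆ 𝒯, 𝒮.Nonempty → (∀ g ∈ 𝔊, ¬ Odd #(𝒮.filter (fun S => S ⊆ g))) → t ∈ 𝒮) :
    #𝒯 ≤ #𝔊 := by
  have htc : tᶜ ∉ 𝒯 := fun htc => hcov t (hY ht) tᶜ htc (Ne.symm htne) (Finset.union_compl t)
  exact card_le_card_of_pivot 𝒯 𝔊 t (hY ht) htc hdep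
    (fun 𝒮 h𝒮 => pure_top_L_row_not_H_combination 𝒯 θ 𝔊 hG hHL Y hY hYfree t ht htmax hrad 𝒮 h𝒮)

end NineType

end Summit.CriticalPhenomena.PercolationContinuityZ3.Theorems
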